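import Summits.QuantumFields.YangMills.Theorems.FluctuationComparisonRegPrIntLS2BetaChartReadDescentChainRule
import Literature.MathematicalPhysics.QuantumFieldTheory.Balaban1983to89.BlockAveragingEMLLinearisedBackground
import HarnessLib

/-!
# S2β · (D1) WHAT `DM` DOES, ONE STEP: THE DERIVATIVE OF THE CHART-READ (0.4) EML AVERAGE IS THE COVARIANT LINEARISED AVERAGE `Q₁^{R₀}(U₀)` UP TO `404·ℓ·α`
# ([Balaban1985Averaging] Prop. 3 (121)–(124) at a small-field background, lit ✓`norm_avgFun_ratio_sub_one_sub_covLinAvgR0_le`, divided along a chart ray)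

Cell `ym3-torus` (YM ladder rung R3 = continuum `SU(2)` Yang–Mills on the three-torus at fixed lattice data — a RUNG: NOT d = 4, NOT infinite volume, NOT a mass gap,
NOT Clay).  Width seat `ym3-torus-px13` (gen 25); crux `stmt-QuantumFields-20520` (`…Theses.UnitScaleTilt.FluctuationComparisonRegPrIntL`), LINE g18-1 S2β, organ GAP♯∘
⟸ (D♮) ∧ (F♮) ⟸ «CRIT♮» ⟸ «MULT♭» = CRIT-m♮ ∧ MULT♮ ∧ AVG₂♭; MULT♮ ⟸ (RINV-curl) ∧ BKG (px16 g21 ✓`…S2BetaMultOfPreimages`), (RINV-curl) = «preimages under `DM` with small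
covariant curl»; `DM := fderiv` of the chart-read descent (✓p823800 ∕ FILE B ∕ FILE C), a product of ONE-STEP derivatives `Dψ_{Ū^i U₀}(0)` ((D0) ✓`…ChartReadDescentChainRule`).
THIS FILE evaluates the one-step derivative — `--kind proof --supports stmt-QuantumFields-20520 --as helper`, count-neutral, DEFINITION-FREE (0 `def`, 0 `instance`,
0 `notation`, 0 `sorry`).

THE STATEMENT (§3 ★★★`norm_fderiv_chartRead_sub_covLinAvgR0_le`, generic `P : Params`, `SU(N)`, level `j`).  For a background `U₀` in the loop `α`-guard (`dist1 (loopHol U₀ c i) ≤ α`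
for all `c i`, `α ≤ 1∕24`, `α < δ_N`) and a direction `X : PBond P j → 𝔰𝔲(N)`:
  **`‖↑((Dψ_{U₀}(0) X) c) − (Q₁^{R₀}(U₀) X̂)(c)‖ ≤ 404·ℓ·α·‖X‖`**,  `ℓ = (d+2)L`,  `X̂ b := ↑(X b)`,  `‖X‖` the sup norm,
with `ψ_{U₀}(A)(c) = Λ(Ū(Θ^B(A)·U₀)(c)·Ū(U₀)(c)⁻¹)` N09's chart-read average and `Q₁^{R₀}(U₀) = covLinAvgR0 U₀` the lit covariant linearised average in `R₀` form.  So
`Dψ_{U₀}(0) = Q₁^{R₀}(U₀) + E_{U₀}` with `‖E_{U₀}‖_{∞→∞} ≤ 404ℓα` — print's «remaining terms … O(L²α₀)» of (124), which the lit file keeps inside its remainder, isolated as an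
OPERATOR defect; exact at the flat background up to this defect's vanishing with `α`.

PROOF ROUTE.  Along the ray `U_t = Θ^B(tX)·U₀` the perturbation is `Y_t(b) = e^{t X̂_b} − 1` (§1), with `t ↦ Y_t` differentiable at `0` with derivative `X̂` and sup norm `δ_t → 0`,
`δ_t∕t → ‖X‖`; the relative average `F(t) = ↑(Ū(U_t) c·Ū(U₀) c⁻¹) − 1` equals `exp(↑(ψ(tX) c)) − 1` near `t = 0` (`Θ ∘ Λ = id` on the window, ✓p823800 `eventually_norm_rel_iter_lt`),
hence has derivative `↑((Dψ(0)X) c)` at `0` ((D0) `hasDerivAt_chartRead_avgFun_ray`, `D exp(0) = id`); `G(t) = (Q₁^{R₀}(U₀) Y_t)(c)` is a continuous linear image of `Y_t`, derivative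
`(Q₁^{R₀}(U₀) X̂)(c)`; the lit estimate bounds `‖F(t) − G(t)‖ ≤ 404·ℓδ_t·(ℓδ_t + α)` for small `t > 0`; §2's slope lemma (`‖D‖ ≤ lim φ` when `‖H t‖ ≤ t·φ t`, `H′(0) = D`,
`H 0 = 0`) concludes with `φ t = 404ℓ·(δ_t∕t)·(ℓδ_t + α) → 404ℓ·‖X‖·α`.

HONEST.  One printed proposition of [Balaban1985Averaging] read as an operator statement about the tree's own averaging, BY NAME over the lit kernel proof; nothing else of
Bałaban's; the column-spread preimage, the curl count and the Neumann inversion of (RINV-curl) are px16 g21's pen and are NOT here; MULT♮, AVG₂♭, CRIT-m♮'s assembly, «CRIT♮»,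
(D♮)∕(F♮), GAP♯∘ (registry UNTOUCHED), the five REGISTERED stubs, S2β, crux 20520, 19936, 19200 and `YM3TorusSU2` are NOT proved; no summit statement is proved by a helper;
rung R3 = SU(2) YM₃ on T³ at fixed lattice data — NOT d = 4, NOT infinite volume, NOT a mass gap, NOT Clay; the Yang–Mills mass gap is NOT proved.  Axioms standard.

References: T. Bałaban, CMP **98** (1985) 17–51 [Balaban1985Averaging] (Prop. 3 (121)–(126) p.36); CMP **109** (1987) 249–301 [Balaban1987RG1] ((0.4), (0.8) p.253).
-/

set_option autoImplicit false

noncomputable section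

open scoped Matrix.Norms.L2Operator Topology
open Filter Set Function

namespace Summit.QuantumFields.YangMills.Theorems.FluctuationComparisonRegPrIntLS2BetaChartReadDerivCovLinAvg

open Literature.MathematicalPhysics.QuantumFieldTheory.Balaban1983to89
open Literature.MathematicalPhysics.QuantumFieldTheory.Balaban1983to89.HaarExponentialChart
open Literature.MathematicalPhysics.QuantumFieldTheory.Balaban1983to89.HaarExponentialChart.IsChartRep
open Literature.MathematicalPhysics.QuantumFieldTheory.Balaban1983to89.BlockAveraging (Small Idx avgFun loopHol blockAvg blockAvg_avg)
open Literature.MathematicalPhysics.QuantumFieldTheory.Balaban1983to89.ExpMeanLog (expMeanLogSU deltaSU)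
open Literature.MathematicalPhysics.QuantumFieldTheory.Balaban1983to89.Node00
open Literature.MathematicalPhysics.QuantumFieldTheory.Balaban1983to89.BlockAveragingEMLLinearisedBackground
  (pertVar covLinAvgR0 covLinAvgR0_add covLinAvgR0_smul norm_covLinAvgR0_le norm_avgFun_ratio_sub_one_sub_covLinAvgR0_le)
open Literature.MathematicalPhysics.QuantumLattice (fundamentalRep fundamentalRep_apply)
open Summit.QuantumFields.YangMills.BalabanUVNodes.N09ChartReadAveragingSmooth
open Summit.QuantumFields.YangMills.Theorems.FluctuationComparisonRegPrIntLS2BetaChartReadDescentOnto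
open Summit.QuantumFields.YangMills.Theorems.FluctuationComparisonRegPrIntLS2BetaChartReadDescentChainRule

variable {P : Params} {N : ℕ} [NeZero N]

/-! ## §1 The perturbation along a chart ray: `Y_t(b) = e^{tX̂_b} − 1` -/

section Ray

variable {j : ℕ}

/-- Along the chart ray `U_t = Θ^B(tX)·U₀` the lit perturbation variable is `Y_t(b) = e^{t X̂_b} − 1`. [cite: Balaban1985Variational, (15) p.280 (bookkeeping)] -/
theorem pertVar_ray (U₀ : GaugeField P j (SU N)) (X : PBond P j → (specialUnitaryLogChart (Fin N)).lie) (t : ℝ) (b : PBond P j) :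
    pertVar U₀ (fun b => (isChartRep_specialUnitaryGroup (n := Fin N)).expChart ((t • X) b) * U₀ b) b =
      NormedSpace.exp (t • ((X b : (specialUnitaryLogChart (Fin N)).lie) : Matrix (Fin N) (Fin N) ℂ)) - 1 := by
  unfold pertVar
  rw [mul_inv_cancel_right, BalabanUVNodes.N09ChartReadAveragingSmooth.coe_expChart, Pi.smul_apply, Submodule.coe_smul]

/-- `t ↦ Y_t` has derivative `X̂` at `t = 0` (bond-wise `d∕dt e^{tX̂_b}|₀ = X̂_b`). [cite: Balaban1985Averaging, (122) p.36 (bookkeeping)] -/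
theorem hasDerivAt_pertVar_ray (U₀ : GaugeField P j (SU N)) (X : PBond P j → (specialUnitaryLogChart (Fin N)).lie) :
    HasDerivAt (fun t : ℝ => fun b : PBond P j =>
        pertVar U₀ (fun b => (isChartRep_specialUnitaryGroup (n := Fin N)).expChart ((t • X) b) * U₀ b) b)
      (fun b => ((X b : (specialUnitaryLogChart (Fin N)).lie) : Matrix (Fin N) (Fin N) ℂ)) 0 := by
  have hfun : (fun t : ℝ => fun b : PBond P j =>
      pertVar U₀ (fun b => (isChartRep_specialUnitaryGroup (n := Fin N)).expChart ((t • X) b) * U₀ b) b) =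
      fun t b => NormedSpace.exp (t • ((X b : (specialUnitaryLogChart (Fin N)).lie) : Matrix (Fin N) (Fin N) ℂ)) - 1 := by
    funext t b; exact pertVar_ray U₀ X t b
  rw [hfun]
  refine hasDerivAt_pi.2 fun b => ?_
  have h := (hasDerivAt_exp_smul_const (𝕂 := ℝ) ((X b : (specialUnitaryLogChart (Fin N)).lie) : Matrix (Fin N) (Fin N) ℂ) (0 : ℝ)).sub_const
    (1 : Matrix (Fin N) (Fin N) ℂ)
  rw [zero_smul, NormedSpace.exp_zero, one_mul] at h
  exact h

/-- `Y_0 = 0`. [cite: Balaban1985Averaging, (122) p.36 (bookkeeping)] -/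
theorem pertVar_ray_zero (U₀ : GaugeField P j (SU N)) (X : PBond P j → (specialUnitaryLogChart (Fin N)).lie) :
    (fun b : PBond P j => pertVar U₀ (fun b => (isChartRep_specialUnitaryGroup (n := Fin N)).expChart (((0 : ℝ) • X) b) * U₀ b) b) = 0 := by
  funext b
  rw [pertVar_ray, zero_smul, NormedSpace.exp_zero, sub_self, Pi.zero_apply]

/-- Near `A = 0` (guard at `U₀`) every relative coarse bond `Ū(Θ^B(A)·U₀)(c)·Ū(U₀)(c)⁻¹` is inside the inner radius of the log chart (one step, any level `j`;
✓`continuousAt_avgFun_of_small` + the continuous chart). [cite: Balaban1987RG1, (0.4) p.253 (bookkeeping)] -/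
theorem eventually_norm_rel_avgFun_lt (U₀ : GaugeField P j (SU N)) (hsmall : ∀ c, Small (expMeanLogSU (n := Fin N)) U₀ c) :
    ∀ᶠ A in 𝓝 (0 : PBond P j → (specialUnitaryLogChart (Fin N)).lie), ∀ c : PBond P (j + 1),
      ‖((avgFun (expMeanLogSU (n := Fin N)) (fun b => (isChartRep_specialUnitaryGroup (n := Fin N)).expChart (A b) * U₀ b) c *
          (avgFun (expMeanLogSU (n := Fin N)) U₀ c)⁻¹ : SU N) : Matrix (Fin N) (Fin N) ℂ) - 1‖ < innerRadius (specialUnitaryLogChart (Fin N)) := by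
  have hc : ContinuousAt (fun A : PBond P j → (specialUnitaryLogChart (Fin N)).lie =>
      avgFun (expMeanLogSU (n := Fin N)) (fun b => (isChartRep_specialUnitaryGroup (n := Fin N)).expChart (A b) * U₀ b)) 0 :=
    (continuousAt_avgFun_of_small U₀ hsmall).comp_of_eq (continuous_piExpChart_translate (P := P) (N := N) U₀).continuousAt
      (piExpChart_translate_zero U₀)
  refine eventually_all.2 fun c => ?_
  have hW : Continuous fun W : GaugeField P (j + 1) (SU N) =>
      ‖((W c * (avgFun (expMeanLogSU (n := Fin N)) U₀ c)⁻¹ : SU N) : Matrix (Fin N) (Fin N) ℂ) - 1‖ :=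
    continuous_norm.comp ((continuous_subtype_val.comp ((continuous_apply c).mul continuous_const)).sub continuous_const)
  have h0 : ‖((avgFun (expMeanLogSU (n := Fin N)) (fun b => (isChartRep_specialUnitaryGroup (n := Fin N)).expChart
        ((0 : PBond P j → (specialUnitaryLogChart (Fin N)).lie) b) * U₀ b) c *
      (avgFun (expMeanLogSU (n := Fin N)) U₀ c)⁻¹ : SU N) : Matrix (Fin N) (Fin N) ℂ) - 1‖ < innerRadius (specialUnitaryLogChart (Fin N)) := by
    rw [piExpChart_translate_zero, mul_inv_cancel, OneMemClass.coe_one, sub_self, norm_zero]; exact innerRadius_pos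
  exact (hW.continuousAt.comp hc).eventually (isOpen_Iio.mem_nhds h0)

end Ray

/-! ## §2 A slope lemma: `‖H′(0)‖ ≤ lim φ` when `‖H t‖ ≤ t·φ t` for small `t > 0` -/

section Slope

variable {E : Type*} [NormedAddCommGroup E] [NormedSpace ℝ E]

/-- If `H 0 = 0`, `H′(0) = D`, `‖H t‖ ≤ t·φ(t)` for small `t > 0` and `φ → a` as `t → 0⁺`, then `‖D‖ ≤ a` (the slope `t⁻¹H(t) → D`). [folklore] -/
theorem norm_deriv_le_of_norm_le_mul {H : ℝ → E} {D : E} (hH : HasDerivAt H D 0) (h0 : H 0 = 0) {φ : ℝ → ℝ} {a : ℝ}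
    (hbound : ∀ᶠ t in 𝓝[>] (0 : ℝ), ‖H t‖ ≤ t * φ t) (hφ : Tendsto φ (𝓝[>] (0 : ℝ)) (𝓝 a)) : ‖D‖ ≤ a := by
  have hslope : Tendsto (fun t : ℝ => t⁻¹ • H t) (𝓝[>] (0 : ℝ)) (𝓝 D) := by
    have h := hH.tendsto_slope_zero_right
    simp only [zero_add, h0, sub_zero] at h
    exact h
  have hnorm : Tendsto (fun t : ℝ => ‖t⁻¹ • H t‖) (𝓝[>] (0 : ℝ)) (𝓝 ‖D‖) := hslope.norm
  refine le_of_tendsto_of_tendsto hnorm hφ ?_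
  have hpos : ∀ᶠ t in 𝓝[>] (0 : ℝ), 0 < t := eventually_mem_nhdsWithin
  filter_upwards [hbound, hpos] with t ht htpos
  rw [norm_smul, norm_inv, Real.norm_of_nonneg htpos.le]
  rw [inv_mul_le_iff₀ htpos]
  exact ht

end Slope

/-! ## §3 The one-step derivative is `covLinAvgR0` up to `404·ℓ·α` -/

section OneStep

variable {j : ℕ}

/-- The lit linearised average `Y ↦ (Q₁^{R₀}(U₀) Y)(c)` is a CONTINUOUS ℝ-LINEAR map of the bond field (a finite sum of transported terms; finite dimension), hence its own
derivative along any differentiable family. [cite: Balaban1985Averaging, (122) p.36 («a first-order polynomial»)] -/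
theorem hasDerivAt_covLinAvgR0_comp (U₀ : GaugeField P j (SU N)) (c : PBond P (j + 1)) {Y : ℝ → PBond P j → Matrix (Fin N) (Fin N) ℂ}
    {Y' : PBond P j → Matrix (Fin N) (Fin N) ℂ} {t₀ : ℝ} (hY : HasDerivAt Y Y' t₀) :
    HasDerivAt (fun t => covLinAvgR0 U₀ (Y t) c) (covLinAvgR0 U₀ Y' c) t₀ := by
  let Lₗ : (PBond P j → Matrix (Fin N) (Fin N) ℂ) →ₗ[ℝ] Matrix (Fin N) (Fin N) ℂ :=
    { toFun := fun Y => covLinAvgR0 U₀ Y c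
      map_add' := fun Y Y' => covLinAvgR0_add U₀ Y Y' c
      map_smul' := fun r Y => by
        have h := covLinAvgR0_smul U₀ (r : ℂ) Y c
        rw [RingHom.id_apply]
        have e1 : ((r : ℂ) • Y : PBond P j → Matrix (Fin N) (Fin N) ℂ) = r • Y := by
          funext b; simp only [Pi.smul_apply, Complex.coe_smul]
        have e2 : ((r : ℂ) • covLinAvgR0 U₀ Y c : Matrix (Fin N) (Fin N) ℂ) = r • covLinAvgR0 U₀ Y c := Complex.coe_smul _ _
        rw [e1, e2] at h
        exact h }
  let L : (PBond P j → Matrix (Fin N) (Fin N) ℂ) →L[ℝ] Matrix (Fin N) (Fin N) ℂ := LinearMap.toContinuousLinearMap Lₗ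
  have hL : ∀ Z, L Z = covLinAvgR0 U₀ Z c := fun Z => rfl
  have h := L.hasFDerivAt.comp_hasDerivAt t₀ hY
  simp only [Function.comp_def, hL] at h
  exact h

/-- ★★★ **THE ONE-STEP DERIVATIVE IS THE COVARIANT LINEARISED AVERAGE UP TO `404·ℓ·α`.**  For a background `U₀` in the loop `α`-guard at every coarse bond (`α ≤ 1∕24`,
`α < δ_N`) and every direction `X : PBond P j → 𝔰𝔲(N)`: `‖↑((Dψ_{U₀}(0) X) c) − (Q₁^{R₀}(U₀) X̂)(c)‖ ≤ 404·ℓ·α·‖X‖` (`ℓ = (d+2)L`, `X̂ b = ↑(X b)`, sup norm).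
[cite: Balaban1985Averaging, Prop. 3 (121)-(126) p.36; Balaban1987RG1, (0.4), (0.8) p.253] -/
theorem norm_fderiv_chartRead_sub_covLinAvgR0_le (U₀ : GaugeField P j (SU N)) {α : ℝ} (hα : ∀ c i, dist1 (loopHol U₀ c i) ≤ α)
    (hα24 : α ≤ 1 / 24) (hαδ : α < deltaSU (Fin N)) (X : PBond P j → (specialUnitaryLogChart (Fin N)).lie) (c : PBond P (j + 1)) :
    ‖((fderiv ℝ (fun (A : PBond P j → (specialUnitaryLogChart (Fin N)).lie) (c : PBond P (j + 1)) =>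
          (isChartRep_specialUnitaryGroup (n := Fin N)).logChart
            (avgFun (expMeanLogSU (n := Fin N)) (fun b => (isChartRep_specialUnitaryGroup (n := Fin N)).expChart (A b) * U₀ b) c *
              (avgFun (expMeanLogSU (n := Fin N)) U₀ c)⁻¹)) 0 X c : (specialUnitaryLogChart (Fin N)).lie) : Matrix (Fin N) (Fin N) ℂ) -
        covLinAvgR0 U₀ (fun b => ((X b : (specialUnitaryLogChart (Fin N)).lie) : Matrix (Fin N) (Fin N) ℂ)) c‖ ≤
      404 * (((P.d + 2) * P.L : ℕ) : ℝ) * α * ‖X‖ := by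
  -- letters
  set h := isChartRep_specialUnitaryGroup (n := Fin N) with hh
  set ℓ : ℝ := (((P.d + 2) * P.L : ℕ) : ℝ) with hℓ
  have hℓ0 : 0 ≤ ℓ := Nat.cast_nonneg _
  have hα0 : 0 ≤ α := (GaugeGroup.dist1_nonneg _).trans (hα c (Classical.arbitrary _))
  have hsmall : ∀ c, Small (expMeanLogSU (n := Fin N)) U₀ c := fun c i => lt_of_le_of_lt (hα c i) hαδ
  set ψ := fun (A : PBond P j → (specialUnitaryLogChart (Fin N)).lie) (c : PBond P (j + 1)) =>
      h.logChart (avgFun (expMeanLogSU (n := Fin N)) (fun b => h.expChart (A b) * U₀ b) c * (avgFun (expMeanLogSU (n := Fin N)) U₀ c)⁻¹) with hψ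
  set U : ℝ → GaugeField P j (SU N) := fun t b => h.expChart ((t • X) b) * U₀ b with hU
  set Y : ℝ → PBond P j → Matrix (Fin N) (Fin N) ℂ := fun t b => pertVar U₀ (U t) b with hYdef
  set Xm : PBond P j → Matrix (Fin N) (Fin N) ℂ := fun b => ((X b : (specialUnitaryLogChart (Fin N)).lie) : Matrix (Fin N) (Fin N) ℂ) with hXm
  set D : Matrix (Fin N) (Fin N) ℂ := ((fderiv ℝ ψ 0 X c : (specialUnitaryLogChart (Fin N)).lie) : Matrix (Fin N) (Fin N) ℂ) with hD
  set Q : Matrix (Fin N) (Fin N) ℂ := covLinAvgR0 U₀ Xm c with hQ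
  -- the relative average along the ray and its derivative
  set F : ℝ → Matrix (Fin N) (Fin N) ℂ := fun t =>
      ((avgFun (expMeanLogSU (n := Fin N)) (U t) c * (avgFun (expMeanLogSU (n := Fin N)) U₀ c)⁻¹ : SU N) : Matrix (Fin N) (Fin N) ℂ) - 1 with hF
  -- (a) `g t := ↑(ψ (tX) c)` has derivative `D` at `0`
  have hray := hasDerivAt_chartRead_avgFun_ray (P := P) (N := N) U₀ hsmall X
  have hg : HasDerivAt (fun t : ℝ => ((ψ (t • X) c : (specialUnitaryLogChart (Fin N)).lie) : Matrix (Fin N) (Fin N) ℂ)) D 0 := by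
    have h1 : HasDerivAt (fun t : ℝ => ψ (t • X) c) (fderiv ℝ ψ 0 X c) 0 := (hasDerivAt_pi.1 hray) c
    exact ((specialUnitaryLogChart (Fin N)).lie.subtypeL).hasFDerivAt.comp_hasDerivAt (0 : ℝ) h1
  -- (b) `exp ∘ g − 1` has derivative `D` at `0`, and equals `F` near `0`
  have hg0 : ((ψ ((0 : ℝ) • X) c : (specialUnitaryLogChart (Fin N)).lie) : Matrix (Fin N) (Fin N) ℂ) = 0 := by
    have h0 : ψ ((0 : ℝ) • X) = 0 := by
      rw [zero_smul]
      funext c'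
      show h.logChart (avgFun (expMeanLogSU (n := Fin N)) (fun b => h.expChart ((0 : PBond P j → (specialUnitaryLogChart (Fin N)).lie) b) * U₀ b) c' *
          (avgFun (expMeanLogSU (n := Fin N)) U₀ c')⁻¹) = 0
      rw [piExpChart_translate_zero, mul_inv_cancel]
      exact BalabanUVNodes.N09AveragingOpenAtSmallFields.logChart_one
    rw [h0]; rfl
  have hexp : HasDerivAt (fun t : ℝ => NormedSpace.exp (((ψ (t • X) c : (specialUnitaryLogChart (Fin N)).lie) : Matrix (Fin N) (Fin N) ℂ)) - 1) D 0 := by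
    have he : HasFDerivAt (NormedSpace.exp : Matrix (Fin N) (Fin N) ℂ → Matrix (Fin N) (Fin N) ℂ)
        ((1 : Matrix (Fin N) (Fin N) ℂ →L[ℂ] Matrix (Fin N) (Fin N) ℂ).restrictScalars ℝ) 0 :=
      (hasFDerivAt_exp_zero (𝕂 := ℂ) (𝔸 := Matrix (Fin N) (Fin N) ℂ)).restrictScalars ℝ
    have hcomp := (he.comp_hasDerivAt_of_eq (0 : ℝ) hg hg0.symm).sub_const (1 : Matrix (Fin N) (Fin N) ℂ)
    simpa using hcomp
  have hwin : ∀ᶠ t in 𝓝 (0 : ℝ), ∀ c' : PBond P (j + 1),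
      ‖((avgFun (expMeanLogSU (n := Fin N)) (U t) c' * (avgFun (expMeanLogSU (n := Fin N)) U₀ c')⁻¹ : SU N) : Matrix (Fin N) (Fin N) ℂ) - 1‖ <
        innerRadius (specialUnitaryLogChart (Fin N)) :=
    (tendsto_ray_nhds_zero X).eventually (eventually_norm_rel_avgFun_lt (P := P) (N := N) U₀ hsmall)
  have hFeq : F =ᶠ[𝓝 (0 : ℝ)] fun t => NormedSpace.exp (((ψ (t • X) c : (specialUnitaryLogChart (Fin N)).lie) : Matrix (Fin N) (Fin N) ℂ)) - 1 := by
    refine hwin.mono fun t ht => ?_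
    have hρ : ‖fundamentalRep (Fin N) (avgFun (expMeanLogSU (n := Fin N)) (U t) c * (avgFun (expMeanLogSU (n := Fin N)) U₀ c)⁻¹) - 1‖ <
        innerRadius (specialUnitaryLogChart (Fin N)) := by rw [fundamentalRep_apply]; exact ht c
    have h1 := h.expChart_logChart hρ
    have h2 := coe_expChart (N := N) (h.logChart (avgFun (expMeanLogSU (n := Fin N)) (U t) c * (avgFun (expMeanLogSU (n := Fin N)) U₀ c)⁻¹))
    rw [h1] at h2
    show ((avgFun (expMeanLogSU (n := Fin N)) (U t) c * (avgFun (expMeanLogSU (n := Fin N)) U₀ c)⁻¹ : SU N) : Matrix (Fin N) (Fin N) ℂ) - 1 =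
      NormedSpace.exp (((ψ (t • X) c : (specialUnitaryLogChart (Fin N)).lie) : Matrix (Fin N) (Fin N) ℂ)) - 1
    rw [h2]
  have hF : HasDerivAt F D 0 := hexp.congr_of_eventuallyEq hFeq
  -- (c) the linearised average along the ray and its derivative
  have hY : HasDerivAt Y Xm 0 := hasDerivAt_pertVar_ray (P := P) (N := N) U₀ X
  have hG : HasDerivAt (fun t => covLinAvgR0 U₀ (Y t) c) Q 0 := hasDerivAt_covLinAvgR0_comp (P := P) (N := N) U₀ c hY
  -- (d) the difference `H = F − G`: `H 0 = 0`, `H′(0) = D − Q`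
  have hH : HasDerivAt (fun t => F t - covLinAvgR0 U₀ (Y t) c) (D - Q) 0 := hF.sub hG
  have hY0 : Y 0 = 0 := pertVar_ray_zero (P := P) (N := N) U₀ X
  have hU0 : U 0 = U₀ := by
    show (fun b => h.expChart (((0 : ℝ) • X) b) * U₀ b) = U₀
    rw [zero_smul]; exact piExpChart_translate_zero U₀
  have hQ0 : covLinAvgR0 U₀ (0 : PBond P j → Matrix (Fin N) (Fin N) ℂ) c = 0 := by
    have h0 := covLinAvgR0_smul U₀ (0 : ℂ) (0 : PBond P j → Matrix (Fin N) (Fin N) ℂ) c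
    rwa [zero_smul, zero_smul] at h0
  have hH0 : F 0 - covLinAvgR0 U₀ (Y 0) c = 0 := by
    rw [hY0, hQ0, sub_zero]
    show ((avgFun (expMeanLogSU (n := Fin N)) (U 0) c * (avgFun (expMeanLogSU (n := Fin N)) U₀ c)⁻¹ : SU N) : Matrix (Fin N) (Fin N) ℂ) - 1 = 0
    rw [hU0, mul_inv_cancel, OneMemClass.coe_one, sub_self]
  -- (e) the sup norm of the perturbation tends to `0`, its slope to `‖X̂‖`
  have hYcont : Tendsto Y (𝓝 (0 : ℝ)) (𝓝 0) := by
    have hc := hY.continuousAt.tendsto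
    rwa [hY0] at hc
  have hYnorm : Tendsto (fun t => ‖Y t‖) (𝓝[>] (0 : ℝ)) (𝓝 0) := by
    have h1 : Tendsto (fun t => ‖Y t‖) (𝓝 (0 : ℝ)) (𝓝 0) := by simpa using hYcont.norm
    exact h1.mono_left nhdsWithin_le_nhds
  have hYslope : Tendsto (fun t : ℝ => ‖t⁻¹ • Y t‖) (𝓝[>] (0 : ℝ)) (𝓝 ‖Xm‖) := by
    have h1 := hY.tendsto_slope_zero_right
    simp only [zero_add, hY0, sub_zero] at h1
    exact h1.norm
  -- (f) the lit estimate, eventually in `t > 0`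
  have h48ev : ∀ᶠ t in 𝓝[>] (0 : ℝ), 48 * (ℓ * ‖Y t‖) ≤ 1 := by
    have hlim : Tendsto (fun t => 48 * (ℓ * ‖Y t‖)) (𝓝[>] (0 : ℝ)) (𝓝 (48 * (ℓ * 0))) := (hYnorm.const_mul ℓ).const_mul 48
    rw [mul_zero, mul_zero] at hlim
    exact (hlim.eventually_lt_const (by norm_num : (0 : ℝ) < 1)).mono fun t ht => ht.le
  have hNev : ∀ᶠ t in 𝓝[>] (0 : ℝ), 2 * (ℓ * ‖Y t‖) + α < deltaSU (Fin N) := by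
    have hlim : Tendsto (fun t => 2 * (ℓ * ‖Y t‖) + α) (𝓝[>] (0 : ℝ)) (𝓝 (2 * (ℓ * 0) + α)) :=
      ((hYnorm.const_mul ℓ).const_mul 2).add_const α
    rw [mul_zero, mul_zero, zero_add] at hlim
    exact hlim.eventually_lt_const hαδ
  have hbound : ∀ᶠ t in 𝓝[>] (0 : ℝ), ‖F t - covLinAvgR0 U₀ (Y t) c‖ ≤ t * (404 * ℓ * ‖t⁻¹ • Y t‖ * (ℓ * ‖Y t‖ + α)) := by
    have hpos : ∀ᶠ t in 𝓝[>] (0 : ℝ), 0 < t := eventually_mem_nhdsWithin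
    filter_upwards [h48ev, hNev, hpos] with t h48 hN htpos
    have hYb : ∀ b, ‖pertVar U₀ (U t) b‖ ≤ ‖Y t‖ := fun b => norm_le_pi_norm (Y t) b
    have hlit := norm_avgFun_ratio_sub_one_sub_covLinAvgR0_le U₀ (U t) (norm_nonneg (Y t)) hYb h48 c (hα c) hα24 hN
    have hstar : star ((avgFun (expMeanLogSU (n := Fin N)) U₀ c : SU N) : Matrix (Fin N) (Fin N) ℂ) =
        (((avgFun (expMeanLogSU (n := Fin N)) U₀ c)⁻¹ : SU N) : Matrix (Fin N) (Fin N) ℂ) := (coe_inv_SU _).symm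
    have hFt : F t = ((avgFun (expMeanLogSU (n := Fin N)) (U t) c : SU N) : Matrix (Fin N) (Fin N) ℂ) *
        star ((avgFun (expMeanLogSU (n := Fin N)) U₀ c : SU N) : Matrix (Fin N) (Fin N) ℂ) - 1 := by
      rw [hstar]; rfl
    have ht0 : t ≠ 0 := htpos.ne'
    calc ‖F t - covLinAvgR0 U₀ (Y t) c‖
        = ‖((avgFun (expMeanLogSU (n := Fin N)) (U t) c : SU N) : Matrix (Fin N) (Fin N) ℂ) *
            star ((avgFun (expMeanLogSU (n := Fin N)) U₀ c : SU N) : Matrix (Fin N) (Fin N) ℂ) - 1 - covLinAvgR0 U₀ (pertVar U₀ (U t)) c‖ := by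
          rw [hFt]
      _ ≤ 404 * (ℓ * ‖Y t‖) * (ℓ * ‖Y t‖ + α) := hlit
      _ = t * (404 * ℓ * ‖t⁻¹ • Y t‖ * (ℓ * ‖Y t‖ + α)) := by
          rw [norm_smul, norm_inv, Real.norm_of_nonneg htpos.le]
          field_simp
  -- (g) the slope lemma
  have hφ : Tendsto (fun t : ℝ => 404 * ℓ * ‖t⁻¹ • Y t‖ * (ℓ * ‖Y t‖ + α)) (𝓝[>] (0 : ℝ)) (𝓝 (404 * ℓ * ‖Xm‖ * (ℓ * 0 + α))) :=
    ((hYslope.const_mul (404 * ℓ))).mul ((hYnorm.const_mul ℓ).add_const α)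
  rw [mul_zero, zero_add] at hφ
  have hmain := norm_deriv_le_of_norm_le_mul hH hH0 hbound hφ
  -- (h) `‖X̂‖ = ‖X‖`
  have hXm : ‖Xm‖ ≤ ‖X‖ := by
    refine (pi_norm_le_iff_of_nonneg (norm_nonneg X)).2 fun b => ?_
    calc ‖Xm b‖ = ‖X b‖ := Submodule.norm_coe (X b)
      _ ≤ ‖X‖ := norm_le_pi_norm X b
  calc ‖D - Q‖ ≤ 404 * ℓ * ‖Xm‖ * α := hmain
    _ ≤ 404 * ℓ * ‖X‖ * α := by gcongr
    _ = 404 * ℓ * α * ‖X‖ := by ring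

end OneStep

end Summit.QuantumFields.YangMills.Theorems.FluctuationComparisonRegPrIntLS2BetaChartReadDerivCovLinAvg

end
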